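import Mathlib
import Summits.ResolutionOfSingularities.ResolutionOfSingularities.Theorems.RadicialJungCleanModelsLens5AbsDerivation
import Summits.ResolutionOfSingularities.ResolutionOfSingularities.Theorems.RadicialJungCleanModelsLens5ArcPotential
import HarnessLib

/-!
# Route `RadicialJung`, crux `CleanModels` (stmt-15917): CLASS (A) of the defect residue — the canonical theorem

Line `Sketch` rev 23 of crux stmt-ResolutionOfSingularities-15917; lead `res-B-lead-1` g3.  OURS; nothing here proves resolution in
characteristic `p`.  The registrar's name of record for class (A) (res-B-lens-1 g2 «class-(A) := Lens5.ClassA.cleanLU3DefectArc_discrete»):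
the rev-18 data of the former stub `stub_cleanLU3Defect` (regular 3-dimensional centre, every centre above `A` a closed point, transcendence
defect, `g₀` with NO best `p`-th-power approximation) at a valuation ring `O` that is DISCRETE OF RANK ONE ⟹ clean local uniformization of the
`K^p`-line of `g₀` — for EVERY ground field and EVERY residue tower, with no derivation hypothesis.  Two lines: LEMMA D-abs
(✓ `Lens5.AbsDerivation.absDerivation_of_forall_pow_ne'`, an absolute derivation moving `g₀` and preserving `A` up to a denominator) feeds
THEOREM P (✓ `Lens5.ArcPotentialProof.arcPotential`, the potential argument along the quadratic sequence); both by res-B-lens-5 g7, ported by the lead.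
-/

noncomputable section

set_option linter.dupNamespace false -- mandated namespace of this single-conjunct summit

open IsLocalRing
open Literature.AlgebraicGeometry.Resolution

namespace Summit.ResolutionOfSingularities.ResolutionOfSingularities.Theorems.RadicialJung.CleanModels

/-- **Class (A) of the defect residue, closed** (= res-B-lens-5's `Lens5.ClassA.cleanLU3DefectArc_discrete`): at a DISCRETE RANK-ONE
zero-dimensional valuation ring with a 3-dimensional regular centre, a non-`p`-th power `g₀` without best `p`-th-power approximation has
clean local uniformization in loose clean form — every ground field of characteristic `p`, every residue tower (the hypotheses
`ringKrullDim A ≤ 3` and «transcendence defect `≠ 0`» are carried for the skeleton's interface and not used). [folklore] -/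
theorem cleanLU3DefectArc_of_discrete :
    ∀ (p : ℕ), p.Prime →
    ∀ (k : Type) [Field k] [CharP k p] (K : Type) [Field K] [Algebra k K]
    (O : ValuationSubring K) (A : Subalgebra k K), A.toSubring ≤ O.toSubring → A.FG → IsFractionRing A K →
    ringKrullDim A ≤ 3 → IsRegularLocalRing (locAtCentre A.toSubring O) →
    ringKrullDim (locAtCentre A.toSubring O) = 3 →
    (∀ (T : Subring K) (hT : T ≤ O.toSubring), A.toSubring ≤ T → (subringCentre T O hT).IsMaximal) →
    ∀ g₀ : K, (∀ c : K, c ^ p ≠ g₀) →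
    (∀ f₀ : K, ∃ f₁ : K, O.valuation (g₀ - f₁ ^ p) < O.valuation (g₀ - f₀ ^ p)) →
    (∀ hk : ∀ c : k, algebraMap k K c ∈ O, transcendenceDefect k O hk ≠ 0) →
    (∃ π : K, π ≠ 0 ∧ (∀ x : K, O.valuation x < 1 → O.valuation x ≤ O.valuation π) ∧
      (∀ x : K, x ≠ 0 → ∃ n : ℕ, O.valuation π ^ n ≤ O.valuation x)) →
    ∃ (A' : Subalgebra k K), A'.toSubring ≤ O.toSubring ∧ A ≤ A' ∧ A'.FG ∧
    ∃ (_ : IsRegularLocalRing (locAtCentre A'.toSubring O)) (c : Fin p → K), (∃ j : Fin p, (j : ℕ) ≠ 0 ∧ c j ≠ 0) ∧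
    ((∃ (d m : ℕ) (hmd : m ≤ d) (t : Fin d → ↥(locAtCentre A'.toSubring O)) (a : Fin m → ℕ) (u : ↥(locAtCentre A'.toSubring O)), IsUnit u ∧
    Ideal.span (Set.range t) = IsLocalRing.maximalIdeal ↥(locAtCentre A'.toSubring O) ∧
    ringKrullDim ↥(locAtCentre A'.toSubring O) = (d : WithBot ℕ∞) ∧ 0 < m ∧ (∀ i, ¬ p ∣ a i) ∧
    (∑ j : Fin p, c j ^ p * g₀ ^ (j : ℕ)) = (u : K) * ∏ i : Fin m, ((t (Fin.castLE hmd i) : ↥(locAtCentre A'.toSubring O)) : K) ^ (a i)) ∨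
    (∃ u : ↥(locAtCentre A'.toSubring O), IsUnit u ∧ (∑ j : Fin p, c j ^ p * g₀ ^ (j : ℕ)) = (u : K) ∧
    ∀ c' : ↥(locAtCentre A'.toSubring O), u - c' ^ p ∉ IsLocalRing.maximalIdeal ↥(locAtCentre A'.toSubring O)) ∨
    (∃ s c' : ↥(locAtCentre A'.toSubring O), (∑ j : Fin p, c j ^ p * g₀ ^ (j : ℕ)) = (s : K) ∧
    s - c' ^ p ∈ IsLocalRing.maximalIdeal ↥(locAtCentre A'.toSubring O) ∧
    s - c' ^ p ∉ IsLocalRing.maximalIdeal ↥(locAtCentre A'.toSubring O) ^ 2)) := by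
  intro p hp k _ _ K _ _ O A hAO hAfg hfrac hdimA hreg hdim3 hzd g₀ hg₀ hdefect htd hdisc
  exact Lens5.ArcPotentialProof.arcPotential p hp k K O A hAO hAfg hfrac hdimA hreg hdim3 hzd g₀ hg₀ hdefect htd hdisc
    (Lens5.AbsDerivation.absDerivation_of_forall_pow_ne' p hp k K A hAfg hfrac g₀ hg₀)

end Summit.ResolutionOfSingularities.ResolutionOfSingularities.Theorems.RadicialJung.CleanModels

end
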